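import Literature.MathematicalPhysics.QuantumFieldTheory.Balaban1983to89.B9Eq368TowerProjGradientLadder

/-!
# `Balaban1983to89.B9Eq368TowerProjWordGradientLetters` — T. Bałaban, *Propagators for lattice gauge theories in a background field*, Commun. Math. Phys. **99** (1985) 389–434
# [Balaban1985BackgroundPropagators] (3.68) p. 403 (*«R(U), P(U) = I − R(U) … satisfy the same bounds»*), (3.25) p. 394, (3.76)–(3.77) p. 405 (the `DRD*` member of `Δ_a` between two
# backgrounds: *«The operator P₁(A) … is a non-local bounded operator and satisfies the bound (3.77)»*), with [Balaban1984PropagatorsII] (2.51) p. 232: **THE FLAT GRADIENT OF THE TWO-BACKGROUND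
# DIFFERENCE OF THE NE9 CHAIN's `k`-LEVEL PROJECTION, AS A `W`-VALUED LOCAL LETTER** — `∃ α_R K δ > 0` BEFORE `n, η, m, U`: on print's small-field class of the MODEL letters, for every
# source `h` of the fine weight-`c₀` site carrier supported over ONE unit block `v` with `‖h‖_∞ ≤ H`, every fine site `x` and direction `μ`:
# `‖(D_1((R_k(U) − R_k(1))h))(x, μ)‖_W ≤ K·α·e^{−δ·d_m(Π(x), v)}·H` (`D_1` the flat `η⁻¹`-difference `covDerivL2K … (adTransportW φ 1)`) — the block majorant of this gen's
# `B9Eq368TowerProjGradientLadder.exists_hasMajorant_diffLetter_RofUk_sub_flat_closed` READ BACK into the chain's letter currency through a generic seam (§1); brick W-a of the bond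
# storey (the smooth word `D_1(W_k(U) − W_k(1))D*_UG₁,k(1)`, `W_k = 1 − R_k`)

statement-level skeleton of published theorems with citation tags; proofs where landed; nothing here is a claim about the Yang–Mills mass gap

CITATION HEADER (lean-in-tree rule).  Audit cell `pub-balaban`, sub-cell `t4`, BINDER row NE9; NE9 crux-team LEAF PROVER 01 (`b2b-balaban-t4-ne9-formalise-leaf-01`, gen 100;
bears_on: R4/N22).  Composition BY NAME: this gen's `B9Eq368TowerProjGradientLadder.exists_hasMajorant_diffLetter_RofUk_sub_flat_closed`; gen 99's `B9Eq342MajorantReadingSeam.blockRow_of_hasMajorant_conj`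
; r06's letters `B9Eq352GradLetters.diffLetter_inl`, `B9Eq352DivFormLetters.{conj_mul, conj_sub, gradLetterF}`, `B9Eq39Adjoint.{covD, R_one}`;
the OWNER's `B11Eq103H1Complex.{covDerivL2K, equiv_covDerivL2K}`, `B5Eq172HodgePositivity.adTransportW_one`, `B9Eq341TowerBlockGeometry.blkK_eq_blockCoord_siteCast`.  Sources:
[Balaban1985BackgroundPropagators] pp. 394, 403, 405 (text layer pp. 6, 15, 17 read by this lineage 2026-08-28); [Balaban1984PropagatorsII] p. 232.  NOTHING of print's proofs is reproduced.

WHAT IS PROVED (sorry-free; proof lane — no `def`).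
* §0 `tdist_le_tdist1` (`ℓ^∞ ≤ ℓ¹` on the coarse torus).
* §1 **`gradRowW_of_hasMajorant_conj_gradLetterF_readA`** — GENERIC SEAM: a block majorant `K` of `conj b (η⁻¹D^{flat}_μ ∘ readA φ T)` over any geometry and block map `bm` gives, for every source
  `h` supported over `bm⁻¹(v)` with `‖h‖_∞ ≤ H`, `‖(D_1(Th))(x, μ)‖_W ≤ M_φ′·(Σ_i‖b_i‖)·M₂·K(bm x, v)·M_φ·H`.
* §2 **`exists_gradLetter_RofUk_sub_flat`** — the statement of the title (rows CLOSED; the flat-side positivity witnesses and the block cut-off family `rr` DISPLAYED as in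
  `B9Eq368TowerProjLadderClosed`).
* §3 **`exists_gradLetter_W_one`** — the flat gradient of the smooth word `W_k(1)h = (1 − R_k(1))h` as a letter `K·e^{−δd}·H` (no small factor; `D_1R_k(1)` itself is NOT bounded).
HONEST SCOPE.  Read-back bookkeeping; constants crude (NOT print's); «NE9 ⇐ the named binders» (O-NE9-1 #5 UNRULED); NE9 NOT PRINTED ∕ NOT PROVED; spine PROVED 0∕9; rung (B)+1 finite T⁴ —
NOT infinite volume, NOT mass gap, NOT BetaPertH, NOT Clay.  HONEST DEPENDENCY: continuum YM on T⁴ ⇐ BetaPertH ∧ nine spine estimates (0/9 proved); BetaPertH ⇐ (D1) ∧ (D4) ∧ CAP+tail; G-an2-4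
gates asym, D1 and NE2/3/4.  NEW file; nothing modified.  Net new unproved facts: 0.
-/

noncomputable section

open scoped BigOperators InnerProductSpace

namespace Literature.MathematicalPhysics.QuantumFieldTheory.Balaban1983to89.B9Eq368TowerProjWordGradientLetters

open B4Sect5Torus (TSite tdist ccoord)
open B7Prop1Explicit (U1 Wcx boxVec)
open B9SectCLatticeCarrier (Bond shift bpos btgt)
open B9Eq311L2Pairing (WL2)
open B11Eq103H1Complex (SiteL2K covDerivL2K equiv_covDerivL2K)
open B9Eq310HessianOperator (adTransportW)
open B9Eq310HessianHermitian (adTransportW_adjoint)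
open B9Eq310DeltaPrime (plaqHolU)
open B9Eq315QTower (towerP UlevOf)
open B9Eq315QTorus (perCfg cornerSite)
open B9Eq316TowerFlatIsOneStep (towerP_eq_fineP_pow siteCast)
open B9Eq326OperatorTower (RofUk)
open B9Eq324DeltaPrimeATower (laplacePrimeAk)
open B9Eq319QprimeTorus (blockCoord)
open B6RandomWalk (HasMajorant)
open B9Thm34Ext (toB6)
open B9Eq39Adjoint (covD R_one)
open B9Eq33CovDerivVector (shiftEquiv covDeriv_apply)
open B9Eq352DivFormLetters (conj conj_mul conj_sub gradLetterF)
open B9Eq352GradLetters (diffLetter diffLetter_inl)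
open B9Eq324PenaltyKernelForm (readA readA_apply readA_sub)
open B9Eq341TowerBlockGeometry (towerGeom dist_towerGeom blkK_eq_blockCoord_siteCast)
open B9Eq357QprimeTowerKernelForm (blkK)
open B9Thm37GlueTorus (tdist1)
open B9Eq342MajorantReadingSeam (blockRow_of_hasMajorant_conj)
open B9Eq368TowerProjGradientLadder (exists_hasMajorant_diffLetter_RofUk_sub_flat_closed)
open B11Eq103H1Complex (greenK)
open B9Eq324DeltaPrimeATower (GpOfUk)
open B9Eq325ProjFormulaTower (QGGQk_pos)
open B6RandomWalk (hasMajorant_mono c1_nonneg)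
open B6RandomWalkHom (HasMajorantHom)
open B4Sect5Proof (weaken)
open B9Eq360Vprime (kerOp liftOp)
open B9Eq357QprimeTowerKernelForm (kQ norm_kQ_le)
open B9Eq324PenaltyKernelForm (sQ readA_id norm_sQ_le)
open B9Eq358TowerKernelSizes (kQ_flatLevels_eq)
open B9Eq376POneLetters (conjHom)
open B9Eq365TowerXOperatorLadder (hasMajorantHom_kerOp_ind hasMajorantHom_liftOp_ind)
open B9Eq33CovDerivVector (adTransport)
open B9Eq342TowerFlatBaseMajorants (exists_hasMajorants_GpOfUk_one norm_adTransportW_UlevOf_one_le star_one_eq_inv_one UlevOf_one_norm_sub_one_le UlevOf_one_mem_U1)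
open B9Eq368TowerFiveFactorWordLadder (hasMajorant_word5)
open B9Eq368TowerProjLadder (conj_readA_RofUk_eq)
open B9Eq326WoodburyLettersTower (exists_local_letter_QGGQInvk_closed)
open B9Eq349TowerSiteRowSeam (hasMajorant_conj_readA_of_siteRow_tdist)
open B9Eq341TowerBlockGeometry (len_towerGeom hdnn_towerGeom)
open B9Eq360LaplacePrimeAkLaw (conj_one)
open B9Eq315QTowerFlat (perCfg_UlevOf_one_mem_U1 norm_Wcx_UlevOf_one_sub_one_le)
open B9Eq310DeltaPrime (plaqHolU_one)

/-! ## §0 `ℓ^∞ ≤ ℓ¹` on the coarse torus -/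

/-- `d_m(y, y′) ≤ d₁(y, y′)` (max of the coordinate distances ≤ their sum). [folklore] [cite: Balaban1984PropagatorsII, (2.36) p.230] -/
theorem tdist_le_tdist1 {d : ℕ} {m : Fin d → ℕ} [∀ i, NeZero (m i)] (y y' : TSite d m) : tdist m y y' ≤ tdist1 m y y' := by
  unfold tdist tdist1
  have h : (Finset.univ.sup (ccoord m y y') : ℕ) ≤ ∑ i, ccoord m y y' i :=
    Finset.sup_le fun i _ => Finset.single_le_sum (f := ccoord m y y') (fun j _ => Nat.zero_le _) (Finset.mem_univ i)
  exact_mod_cast h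

/-! ## §1 The seam: block majorant of the gradient letter ⟹ `W`-valued gradient row -/

section Seam

variable {d : ℕ} {P : Fin d → ℕ} {𝔸 : Type*} [NormedRing 𝔸] [NormedAlgebra ℂ 𝔸] {W : Type*} [NormedAddCommGroup W] [InnerProductSpace ℂ W]
  (φ : W ≃ₗ[ℂ] 𝔸) {c₀ : ℝ} [Fact (0 < c₀)] {Mφ Mφ' : ℝ} (hMφ : 0 ≤ Mφ) (hMφ' : 0 ≤ Mφ') (hφ : ∀ w, ‖φ w‖ ≤ Mφ * ‖w‖) (hφ' : ∀ X, ‖φ.symm X‖ ≤ Mφ' * ‖X‖)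
  {ι : Type} [Fintype ι] (b : Module.Basis ι ℝ 𝔸) {M₂ : ℝ} (hM₂ : 0 ≤ M₂) (hrepr : ∀ (v : 𝔸) (i : ι), |b.repr v i| ≤ M₂ * ‖v‖)
  {G : B6.Geometry} (bm : TSite d P → G.Site)
include hMφ hMφ' hφ hφ' hM₂ hrepr

/-- **GENERIC SEAM**: if `conj b (c•D^{flat}_μ ∘ readA φ T) ≺ K` over the block map `(x, i) ↦ bm x`, then for every source `h` vanishing off `bm⁻¹(v)` with `‖h(y)‖_W ≤ H`, every site `x`:
`‖(covDerivL2K c (adTransportW φ 1) (Th))(x, μ)‖_W ≤ M_φ′·((Σ_i‖b_i‖)·M₂·K(bm x, v))·(M_φ·H)` — the flat `η⁻¹`-difference of `Th` read in `W` (`blockRow_of_hasMajorant_conj` on the `𝔸`-valued source `φ ∘ h`,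
`gradLetterF_apply`, `R(1) = 1`, `φ⁻¹ ∘ φ = 1`). [cite: Balaban1985BackgroundPropagators, (3.3) p.391, Thm 3.1 (3.42) p.397; Balaban1984PropagatorsII, (2.51) p.232] -/
theorem gradRowW_of_hasMajorant_conj_gradLetterF_readA (T : SiteL2K ℂ d P c₀ W →ₗ[ℂ] SiteL2K ℂ d P c₀ W) (c : ℂ) (μ : Fin d) (K : G.Site → G.Site → ℝ)
    (hT : HasMajorant (g := G) (fun p : TSite d P × ι => bm p.1)
      (conj b (gradLetterF (fun ν => shiftEquiv (Pd := P) ν) (fun ν y => (fun _ : Bond d P => (1 : 𝔸ˣ)) (y, ν)) c μ * readA φ T)) K)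
    (v : G.Site) (h : SiteL2K ℂ d P c₀ W) (H : ℝ) (hH : 0 ≤ H)
    (hoff : ∀ y, bm y ≠ v → WL2.equiv ℂ (fun _ : TSite d P => c₀) W h y = 0) (hbd : ∀ y, bm y = v → ‖WL2.equiv ℂ (fun _ : TSite d P => c₀) W h y‖ ≤ H)
    (x : TSite d P) :
    ‖WL2.equiv ℂ (fun _ : Bond d P => c₀) W (covDerivL2K ℂ c₀ c (adTransportW φ (fun _ : Bond d P => (1 : 𝔸ˣ))) (T h)) (x, μ)‖ ≤
      Mφ' * ((∑ i, ‖b i‖) * M₂ * K (bm x) v) * (Mφ * H) := by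
  set g : TSite d P → 𝔸 := fun y => φ (WL2.equiv ℂ (fun _ : TSite d P => c₀) W h y) with hg
  have hgoff : ∀ y, bm y ≠ v → g y = 0 := fun y hy => by simp only [hg, hoff y hy, map_zero]
  have hgbd : ∀ y, bm y = v → ‖g y‖ ≤ Mφ * H := fun y hy => (hφ _).trans (mul_le_mul_of_nonneg_left (hbd y hy) hMφ)
  have hrow := blockRow_of_hasMajorant_conj b bm hM₂ hrepr _ K hT v g (Mφ * H) (mul_nonneg hMφ hH) hgoff hgbd x
  rw [Module.End.mul_apply, B9Eq352DivFormLetters.gradLetterF_apply] at hrow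
  -- `readA φ T g = φ ∘ (Th)`
  have hh : ((WL2.equiv ℂ (fun _ : TSite d P => c₀) W).symm fun z => φ.symm (g z)) = h := by
    apply (WL2.equiv ℂ (fun _ : TSite d P => c₀) W).injective
    rw [Equiv.apply_symm_apply]
    funext z; simp [hg]
  have hread : ∀ y, readA φ T g y = φ (WL2.equiv ℂ (fun _ : TSite d P => c₀) W (T h) y) := fun y => by rw [readA_apply, hh]
  have hD : covD (fun ν => shiftEquiv (Pd := P) ν) (fun ν y => (fun _ : Bond d P => (1 : 𝔸ˣ)) (y, ν)) μ (readA φ T g) x =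
      φ (WL2.equiv ℂ (fun _ : TSite d P => c₀) W (T h) (shift μ x) - WL2.equiv ℂ (fun _ : TSite d P => c₀) W (T h) x) := by
    simp only [covD, R_one, hread, map_sub]
    rfl
  rw [hD, ← map_smul] at hrow
  rw [equiv_covDerivL2K, covDeriv_apply, B5Eq172HodgePositivity.adTransportW_one, LinearMap.id_apply]
  calc ‖c • (WL2.equiv ℂ (fun _ : TSite d P => c₀) W (T h) (btgt (x, μ)) - WL2.equiv ℂ (fun _ : TSite d P => c₀) W (T h) (bpos (x, μ)))‖
      = ‖φ.symm (φ (c • (WL2.equiv ℂ (fun _ : TSite d P => c₀) W (T h) (shift μ x) - WL2.equiv ℂ (fun _ : TSite d P => c₀) W (T h) x)))‖ := by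
        rw [LinearEquiv.symm_apply_apply]
    _ ≤ Mφ' * ‖φ (c • (WL2.equiv ℂ (fun _ : TSite d P => c₀) W (T h) (shift μ x) - WL2.equiv ℂ (fun _ : TSite d P => c₀) W (T h) x))‖ := hφ' _
    _ ≤ Mφ' * ((∑ i, ‖b i‖) * M₂ * K (bm x) v * (Mφ * H)) := mul_le_mul_of_nonneg_left hrow hMφ'
    _ = Mφ' * ((∑ i, ‖b i‖) * M₂ * K (bm x) v) * (Mφ * H) := by ring

end Seam

/-! ## §2 The flat gradient of `(R_k(U) − R_k(1))h` as a local letter, constants before the lattice -/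

section Main

variable {d : ℕ} (L : ℕ) [NeZero L] {𝔸 : Type*} [NormedRing 𝔸] [NormedAlgebra ℂ 𝔸] [CompleteSpace 𝔸] [NormOneClass 𝔸] [StarRing 𝔸] [NormedStarGroup 𝔸] [StarModule ℂ 𝔸]
  [FiniteDimensional ℂ 𝔸]
  {W : Type*} [NormedAddCommGroup W] [InnerProductSpace ℂ W] [FiniteDimensional ℂ W] (φ : W ≃ₗ[ℂ] 𝔸) {a a' Mφ Mφ' : ℝ}
  (hMφ : 0 ≤ Mφ) (hMφ' : 0 ≤ Mφ') (hφn : ∀ w, ‖φ w‖ ≤ Mφ * ‖w‖) (hφn' : ∀ X, ‖φ.symm X‖ ≤ Mφ' * ‖X‖) (ha : 0 < a) (ha' : 0 < a')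
  {r : ℝ} (hr0 : 0 ≤ r) (hr1 : r < 1)
  (τ : 𝔸 →ₗ[ℂ] ℂ) {Cτ : ℝ} (hτ : ∀ X, ‖τ X‖ ≤ Cτ * ‖X‖) (hCτ : 0 ≤ Cτ) {ρw : ℝ} (hρw : 0 ≤ ρw)
  (hτ₁ : ∀ X : 𝔸, τ (star X) = starRingEnd ℂ (τ X)) (hτ₂ : ∀ X Y : 𝔸, τ (X * Y) = τ (Y * X)) (hφτ : ∀ X Y : 𝔸, ⟪φ.symm X, φ.symm Y⟫_ℂ = τ (star X * Y))
  {Mτ : ℝ} (hMτ : 0 ≤ Mτ)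
  {ι : Type} [Fintype ι] [DecidableEq ι] (b : Module.Basis ι ℝ 𝔸) {M₂ : ℝ} (hM₂ : 0 ≤ M₂) (hrepr : ∀ (v : 𝔸) (i : ι), |b.repr v i| ≤ M₂ * ‖v‖)

include hMφ hMφ' hφn hφn' ha ha' hr0 hr1 hτ hCτ hρw hτ₁ hτ₂ hφτ hMτ hM₂ hrepr in
/-- **THE FLAT GRADIENT OF `(R_k(U) − R_k(1))h` AS A `W`-VALUED LOCAL LETTER, CONSTANTS BEFORE THE LATTICE** — see the module docstring.
[cite: Balaban1985BackgroundPropagators, (3.68) p.403, (3.25) p.394, (3.76)–(3.77) p.405, Thm 3.1 (3.42) p.397; Balaban1984PropagatorsII, (2.51) p.232] -/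
theorem exists_gradLetter_RofUk_sub_flat (hd : 1 ≤ d) (hL : 1 ≤ L) (hL3 : 3 ≤ L) :
    ∃ αR K δ : ℝ, 0 < αR ∧ 0 ≤ K ∧ 0 < δ ∧
      ∀ (n : ℕ) (η : ℝ), η * (L : ℝ) ^ (n + 1) = 1 →
      ∀ (c₀ c₁ : ℝ) [Fact (0 < c₀)] [Fact (0 < c₁)], c₀ * ((L : ℝ) ^ (n + 1)) ^ d = c₁ → |η| ^ d / c₀ ≤ ρw →
      ∀ (m : Fin d → ℕ) [∀ i, NeZero (m i)], (∀ i, 1 ≤ m i) → ∀ (U : Bond d (towerP L m (n + 1)) → 𝔸ˣ) (α : ℝ), 0 ≤ α → α ≤ αR →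
        (∀ bd, U bd ∈ U1 𝔸) → (∀ bd, ‖(U bd : 𝔸) - 1‖ ≤ α * η) →
        (∀ (x : TSite d (towerP L m (n + 1))) (μ ν : Fin d), ‖(U (shift ν x, μ) : 𝔸) - (U (x, μ) : 𝔸)‖ ≤ α * η ^ 2) →
        (∀ p : B9SectCLatticeCarrier.Plaq d (towerP L m (n + 1)), ‖(plaqHolU U p : 𝔸) - 1‖ ≤ α * η ^ 2) →
      ∀ (hUst : ∀ bd, star (U bd : 𝔸) = (((U bd)⁻¹ : 𝔸ˣ) : 𝔸))
        (αU : ℕ → ℝ), (∀ j, αU j ≤ 1 / 64) →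
        (∀ (j : ℕ) (x : B7Prop1Explicit.Site d) (k : Fin d), perCfg (towerP L m (j + 1)) (UlevOf L m (n + 1) U j) x k ∈ U1 𝔸) →
        (∀ (j : ℕ) (y : TSite d (towerP L m j)) (k : Fin d) (ρ' : Fin d → Fin L),
          ‖((Wcx L (perCfg (towerP L m (j + 1)) (UlevOf L m (n + 1) U j)) (cornerSite L y) k (boxVec L ρ') : 𝔸ˣ) : 𝔸) - 1‖ ≤ αU j) →
      ∀ (εU : ℕ → ℝ), (∀ j, 0 ≤ εU j) → (∀ j, εU j ≤ 1) → (∀ j < n + 1, εU j ≤ α * r ^ j) →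
        (∀ (j : ℕ) (bd : Bond d (towerP L m (j + 1))), ‖(UlevOf L m (n + 1) U j bd : 𝔸) - 1‖ ≤ εU j) →
        (∀ (j : ℕ) (bd : Bond d (towerP L m (j + 1))), UlevOf L m (n + 1) U j bd ∈ U1 𝔸) →
        (∀ (j : ℕ) (bd : Bond d (towerP L m (j + 1))) (w : W), ‖adTransportW φ (UlevOf L m (n + 1) U j) bd w‖ ≤ ‖w‖) →
      ∀ (hposU : ∀ x : SiteL2K ℂ d (towerP L m (n + 1)) c₀ W, x ≠ 0 → 0 < RCLike.re ⟪x, laplacePrimeAk L m n φ η U a' (c₁ := c₁) x⟫_ℂ)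
        (hpos₁ : ∀ x : SiteL2K ℂ d (towerP L m (n + 1)) c₀ W, x ≠ 0 →
          0 < RCLike.re ⟪x, laplacePrimeAk L m n φ η (fun _ : Bond d (towerP L m (n + 1)) => (1 : 𝔸ˣ)) a' (c₁ := c₁) x⟫_ℂ)
        (rr : TSite d m → SiteL2K ℂ d m c₁ W →L[ℂ] SiteL2K ℂ d m c₁ W),
        (∀ (y : TSite d m) (g : SiteL2K ℂ d m c₁ W) (y' : TSite d m),
          WL2.equiv ℂ (fun _ : TSite d m => c₁) W (rr y g) y' = if y' = y then WL2.equiv ℂ (fun _ : TSite d m => c₁) W g y' else 0) →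
      ∀ (v : TSite d m) (h : SiteL2K ℂ d (towerP L m (n + 1)) c₀ W) (H : ℝ),
        (∀ y, blockCoord (L ^ (n + 1)) m (siteCast (towerP_eq_fineP_pow L m (n + 1)) y) ≠ v →
          WL2.equiv ℂ (fun _ : TSite d (towerP L m (n + 1)) => c₀) W h y = 0) →
        (∀ y, ‖WL2.equiv ℂ (fun _ : TSite d (towerP L m (n + 1)) => c₀) W h y‖ ≤ H) →
      ∀ (x : TSite d (towerP L m (n + 1))) (μ : Fin d),
        ‖WL2.equiv ℂ (fun _ : Bond d (towerP L m (n + 1)) => c₀) W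
            (covDerivL2K ℂ c₀ ((η : ℂ))⁻¹ (adTransportW φ (fun _ : Bond d (towerP L m (n + 1)) => (1 : 𝔸ˣ)))
              ((RofUk L m n φ η U (c₀ := c₀) - RofUk L m n φ η (fun _ : Bond d (towerP L m (n + 1)) => (1 : 𝔸ˣ)) (c₀ := c₀)) h)) (x, μ)‖ ≤
          K * α * Real.exp (-(δ * tdist m (blockCoord (L ^ (n + 1)) m (siteCast (towerP_eq_fineP_pow L m (n + 1)) x)) v)) * H := by
  obtain ⟨αR, K, δ, hαR, hK, hδ, HD⟩ := exists_hasMajorant_diffLetter_RofUk_sub_flat_closed L φ hMφ hMφ' hφn hφn' ha ha' hr0 hr1 τ hτ hCτ hρw hτ₁ hτ₂ hφτ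
    hMτ b hM₂ hrepr hd hL hL3
  have hSb : 0 ≤ ∑ i, ‖b i‖ := Finset.sum_nonneg fun i _ => norm_nonneg _
  refine ⟨αR, Mφ' * ((∑ i, ‖b i‖) * M₂ * K) * Mφ, δ, hαR, by positivity, hδ, ?_⟩
  intro n η hη c₀ c₁ _ _ hc hρη m _ hm U α hα0 hαle hU1 hUs hUw hpl hUst αU hα1 hU1p hreg εU hε0 hε1 hεr hlev hlev1 hRlev hposU hpos₁ rr hrr
    v h H hoff hbd x μ
  have hH : 0 ≤ H := by
    have h0 := hbd x; exact (norm_nonneg _).trans h0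
  -- the block majorant of the gradient letter of the difference, in the product form of the seam
  have hT := HD n η hη c₀ c₁ hc hρη m hm U α hα0 hαle hU1 hUs hUw hpl hUst αU hα1 hU1p hreg εU hε0 hε1 hεr hlev hlev1 hRlev hposU hpos₁ rr hrr 0 0 True (Sum.inl μ)
  rw [diffLetter_inl, ← conj_sub, ← readA_sub, ← B9Eq352DivFormLetters.conj_mul] at hT
  -- read back
  have hoff' : ∀ y, blkK L m n y ≠ v → WL2.equiv ℂ (fun _ : TSite d (towerP L m (n + 1)) => c₀) W h y = 0 := fun y hy =>
    hoff y (by rwa [← blkK_eq_blockCoord_siteCast])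
  have hbd' : ∀ y, blkK L m n y = v → ‖WL2.equiv ℂ (fun _ : TSite d (towerP L m (n + 1)) => c₀) W h y‖ ≤ H := fun y _ => hbd y
  have hrow := gradRowW_of_hasMajorant_conj_gradLetterF_readA φ hMφ hMφ' hφn hφn' b hM₂ hrepr (G := toB6 (towerGeom L m n η 0) 0 True) (blkK L m n)
    _ _ μ _ hT v h H hH hoff' hbd' x
  rw [LinearMap.sub_apply] at hrow ⊢
  refine hrow.trans ?_
  -- `e^{−δ d₁} ≤ e^{−δ d_∞}`
  have hdist : (toB6 (towerGeom L m n η 0) 0 True).dist (blkK L m n x) v = tdist1 m (blkK L m n x) v := rfl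
  have hexp : Real.exp (-(δ * (toB6 (towerGeom L m n η 0) 0 True).dist (blkK L m n x) v)) ≤
      Real.exp (-(δ * tdist m (blockCoord (L ^ (n + 1)) m (siteCast (towerP_eq_fineP_pow L m (n + 1)) x)) v)) := by
    rw [hdist, ← blkK_eq_blockCoord_siteCast]
    exact Real.exp_le_exp.mpr (by nlinarith [tdist_le_tdist1 (blkK L m n x) v, hδ.le])
  have hK' : 0 ≤ K * α := mul_nonneg hK hα0
  calc Mφ' * ((∑ i, ‖b i‖) * M₂ * (K * α * Real.exp (-(δ * (toB6 (towerGeom L m n η 0) 0 True).dist (blkK L m n x) v)))) * (Mφ * H)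
      ≤ Mφ' * ((∑ i, ‖b i‖) * M₂ * (K * α * Real.exp (-(δ * tdist m (blockCoord (L ^ (n + 1)) m (siteCast (towerP_eq_fineP_pow L m (n + 1)) x)) v)))) * (Mφ * H) := by
        gcongr
    _ = Mφ' * ((∑ i, ‖b i‖) * M₂ * K) * Mφ * α *
          Real.exp (-(δ * tdist m (blockCoord (L ^ (n + 1)) m (siteCast (towerP_eq_fineP_pow L m (n + 1)) x)) v)) * H := by ring


/-! ## §3 The flat gradient of the smooth word `W_k(1) = 1 − R_k(1)` as a local letter, constants before the lattice -/

/-- `X * (P ∘ R) = (X * P) ∘ R` on `Module.End` (definitional). [folklore] -/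
private theorem mul_comp_eq {V : Type*} [AddCommGroup V] [Module ℝ V] (X P R : Module.End ℝ V) :
    X * (P ∘ₗ R) = (X * P) ∘ₗ R := rfl
set_option maxHeartbeats 400000 in
omit [DecidableEq ι] in
include hMφ hMφ' hφn hφn' ha ha' hr0 hr1 hτ hCτ hρw hτ₁ hτ₂ hφτ hMτ hM₂ hrepr in
/-- **THE FLAT GRADIENT OF `W_k(1)h = (1 − R_k(1))h` AS A `W`-VALUED LOCAL LETTER, CONSTANTS BEFORE THE LATTICE** (`W_k(1) = G′_kS c_kA G′_k` at the vacuum, (3.25)): `∃ K δ`, for every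
lattice on print's diagonal, every source `h` over ONE unit block `v` with `‖h‖_∞ ≤ H`: `‖(D_1(W_k(1)h))(x, μ)‖_W ≤ K·e^{−δ d_m(Πx, v)}·H` — the five-factor word majorant with the GRADIENT
row (3.42)₂ as first factor (`B9Eq342TowerFlatBaseMajorants`, `hasMajorant_word5`, the block-diagonal letters of `S`, `A`, the OWNER's closed rows of `c_k(1)`), read back by §1.  The bare
flat derivative `D_1R_k(1)` is NOT bounded (it contains `D_1` itself); only the smooth word is.
[cite: Balaban1985BackgroundPropagators, (3.25) p.394, (3.68) p.403, Thm 3.1 (3.42) p.397, Thm 3.2 (3.48) p.398, Thm 3.11 p.416; Balaban1984PropagatorsII, (2.51)–(2.55) p.232, (2.66) p.234] -/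
theorem exists_gradLetter_W_one (hd : 1 ≤ d) (hL : 1 ≤ L) (hL3 : 3 ≤ L) :
    ∃ K δ : ℝ, 0 ≤ K ∧ 0 < δ ∧
      ∀ (n : ℕ) (η : ℝ), η * (L : ℝ) ^ (n + 1) = 1 →
      ∀ (c₀ c₁ : ℝ) [Fact (0 < c₀)] [Fact (0 < c₁)], c₀ * ((L : ℝ) ^ (n + 1)) ^ d = c₁ → |η| ^ d / c₀ ≤ ρw →
      ∀ (m : Fin d → ℕ) [∀ i, NeZero (m i)], (∀ i, 1 ≤ m i) →
      ∀ (hpos₁ : ∀ x : SiteL2K ℂ d (towerP L m (n + 1)) c₀ W, x ≠ 0 →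
          0 < RCLike.re ⟪x, laplacePrimeAk L m n φ η (fun _ : Bond d (towerP L m (n + 1)) => (1 : 𝔸ˣ)) a' (c₁ := c₁) x⟫_ℂ)
        (rr : TSite d m → SiteL2K ℂ d m c₁ W →L[ℂ] SiteL2K ℂ d m c₁ W),
        (∀ (y : TSite d m) (g : SiteL2K ℂ d m c₁ W) (y' : TSite d m),
          WL2.equiv ℂ (fun _ : TSite d m => c₁) W (rr y g) y' = if y' = y then WL2.equiv ℂ (fun _ : TSite d m => c₁) W g y' else 0) →
      ∀ (v : TSite d m) (h : SiteL2K ℂ d (towerP L m (n + 1)) c₀ W) (H : ℝ),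
        (∀ y, blockCoord (L ^ (n + 1)) m (siteCast (towerP_eq_fineP_pow L m (n + 1)) y) ≠ v →
          WL2.equiv ℂ (fun _ : TSite d (towerP L m (n + 1)) => c₀) W h y = 0) →
        (∀ y, ‖WL2.equiv ℂ (fun _ : TSite d (towerP L m (n + 1)) => c₀) W h y‖ ≤ H) →
      ∀ (x : TSite d (towerP L m (n + 1))) (μ : Fin d),
        ‖WL2.equiv ℂ (fun _ : Bond d (towerP L m (n + 1)) => c₀) W
            (covDerivL2K ℂ c₀ ((η : ℂ))⁻¹ (adTransportW φ (fun _ : Bond d (towerP L m (n + 1)) => (1 : 𝔸ˣ)))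
              (((LinearMap.id : SiteL2K ℂ d (towerP L m (n + 1)) c₀ W →ₗ[ℂ] SiteL2K ℂ d (towerP L m (n + 1)) c₀ W) -
                RofUk L m n φ η (fun _ : Bond d (towerP L m (n + 1)) => (1 : 𝔸ˣ)) (c₀ := c₀)) h)) (x, μ)‖ ≤
          K * Real.exp (-(δ * tdist m (blockCoord (L ^ (n + 1)) m (siteCast (towerP_eq_fineP_pow L m (n + 1)) x)) v)) * H := by
  classical
  -- (0) the rows at the vacuum: G′_k (value, gradient), c_k (closed), and their constants
  obtain ⟨BG, δ₀, hBG, hδ₀, hbase⟩ := exists_hasMajorants_GpOfUk_one L φ (a' := a') hMφ hMφ' hφn hφn' ha' τ hτ₂ hφτ b hM₂ hrepr hd hL3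
  obtain ⟨α₁, C, ρ, hα₁, hC, hρ, ROW⟩ :=
    exists_local_letter_QGGQInvk_closed hd L hL hL3 φ hMφ hMφ' hφn hφn' ha ha' hr0 hr1 τ hτ hCτ hρw hτ₁ hτ₂ hφτ hMτ
  have hSb : 0 ≤ ∑ i, ‖b i‖ := Finset.sum_nonneg fun i _ => norm_nonneg _
  set κ : ℝ := M₂ * ∑ i, ‖b i‖ with hκ
  have hκ0 : 0 ≤ κ := mul_nonneg hM₂ hSb
  set Kc : ℝ := M₂ * (∑ i, ‖b i‖) * (Mφ * Mφ') * C with hKc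
  have hKc0 : 0 ≤ Kc := by positivity
  have hδc : 0 < ρ / d := div_pos hρ (by exact_mod_cast hd)
  set δm : ℝ := min δ₀ (ρ / d) with hδm
  have hδm0 : 0 < δm := lt_min hδ₀ hδc
  have hδm₀ : δm ≤ δ₀ := min_le_left _ _
  have hδmc : δm ≤ ρ / d := min_le_right _ _
  have hc1h : 0 ≤ B6.c1 d δm (1 / 2) := c1_nonneg d _ _
  set KW : ℝ := BG * B6.c1 d δm (1 / 2) * (Mφ * Mφ' * κ * (Kc * (1 * κ) * B6.c1 d δm (1 / 2) * BG)) with hKW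
  have hKW0 : 0 ≤ KW := by positivity
  refine ⟨Mφ' * ((∑ i, ‖b i‖) * M₂ * KW) * Mφ, (1 - 1 / 2) * δm, by positivity, by nlinarith, ?_⟩
  intro n η hη c₀ c₁ _ _ hc hρη m _ hm hpos₁ rr hrr v h H hoff hbd x μ
  have hH : 0 ≤ H := (norm_nonneg _).trans (hbd x)
  have hc₀ : (0 : ℝ) < c₀ := Fact.out
  have hw1 : (c₁ / c₀) * (((L : ℝ) ^ (n + 1)) ^ d)⁻¹ = 1 := by rw [← hc]; field_simp
  have hlen1 : ∀ a : (towerGeom L m n η 0).Site, (towerGeom L m n η 0).len a = 1 := fun a => by rw [len_towerGeom, mul_comm]; exact hη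
  have hdnn := hdnn_towerGeom L m n η 0
  -- (1) the five factors at the vacuum over `towerGeom … 0`, `Rr := 0`, `H := True`, common rate `δm`
  obtain ⟨h342_1, h342_2, -⟩ := hbase n η hη c₀ c₁ hc m hpos₁ 0 0 True
  have hF : HasMajorant (g := toB6 (towerGeom L m n η 0) 0 True) (fun p : TSite d (towerP L m (n + 1)) × ι => blkK L m n p.1)
      (conj b (readA φ (GpOfUk L m n φ η (fun _ : Bond d (towerP L m (n + 1)) => (1 : 𝔸ˣ)) a' (c₁ := c₁) hpos₁)))
      (fun a a'' => BG * Real.exp (-(δm * (towerGeom L m n η 0).dist a a''))) :=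
    hasMajorant_mono _ h342_1 fun a a'' => by rw [hlen1 a, one_pow, mul_one]; exact weaken hBG.le le_rfl hδm₀ (hdnn a a'')
  have hXF : HasMajorant (g := toB6 (towerGeom L m n η 0) 0 True) (fun p : TSite d (towerP L m (n + 1)) × ι => blkK L m n p.1)
      (conj b (gradLetterF (fun ν => shiftEquiv (Pd := towerP L m (n + 1)) ν) (fun ν y => (fun _ : Bond d (towerP L m (n + 1)) => (1 : 𝔸ˣ)) (y, ν)) ((η : ℂ))⁻¹ μ) *
        conj b (readA φ (GpOfUk L m n φ η (fun _ : Bond d (towerP L m (n + 1)) => (1 : 𝔸ˣ)) a' (c₁ := c₁) hpos₁)))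
      (fun a a'' => BG * Real.exp (-(δm * (towerGeom L m n η 0).dist a a''))) := by
    have h := h342_2 (Sum.inl μ)
    rw [diffLetter_inl] at h
    exact hasMajorant_mono _ h fun a a'' => by rw [hlen1 a, mul_one]; exact weaken hBG.le le_rfl hδm₀ (hdnn a a'')
  have hrow1 := hasMajorant_conj_readA_of_siteRow_tdist L m n η 0 0 True φ hMφ hMφ' hφn hφn' b hM₂ hrepr hd
    (greenK _ (QGGQk_pos L m n φ c₀ η (fun _ : Bond d (towerP L m (n + 1)) => (1 : 𝔸ˣ)) c₁ a' (adTransportW_adjoint φ τ hτ₂ (star_one_eq_inv_one L m n) hφτ) hpos₁)) hC hρ.le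
    (fun v g F hgv hgF x => ROW n η hη c₀ c₁ hc hρη m hm (fun _ : Bond d (towerP L m (n + 1)) => (1 : 𝔸ˣ)) (fun _ => 0) (fun _ => by norm_num)
      (perCfg_UlevOf_one_mem_U1 L m (n + 1)) (norm_Wcx_UlevOf_one_sub_one_le L m (n + 1) (fun _ => 0) (fun _ => le_rfl))
      (fun _ => 0) (fun _ => le_rfl) (UlevOf_one_norm_sub_one_le L m n) (UlevOf_one_mem_U1 L m n) 0 le_rfl hα₁.le (star_one_eq_inv_one L m n)
      (fun _ => one_mem _) (fun _ => by simp only [Units.val_one, sub_self, norm_zero, zero_mul]; exact le_rfl)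
      (fun _ => by simp only [plaqHolU_one, Units.val_one, sub_self, norm_zero, zero_mul]; exact le_rfl) (fun _ _ => by simp) hpos₁ rr hrr v g F hgv hgF x)
  have hc1 : HasMajorant (g := toB6 (towerGeom L m n η 0) 0 True) (fun q : TSite d m × ι => q.1)
      (conj b (readA φ (greenK _ (QGGQk_pos L m n φ c₀ η (fun _ : Bond d (towerP L m (n + 1)) => (1 : 𝔸ˣ)) c₁ a' (adTransportW_adjoint φ τ hτ₂ (star_one_eq_inv_one L m n) hφτ) hpos₁))))
      (fun a a'' => Kc * Real.exp (-(δm * (towerGeom L m n η 0).dist a a''))) :=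
    hasMajorant_mono _ hrow1 fun a a'' => weaken hKc0 le_rfl hδmc (hdnn a a'')
  have hA1 : HasMajorantHom (g := toB6 (towerGeom L m n η 0) 0 True) (fun p : TSite d (towerP L m (n + 1)) × ι => blkK L m n p.1) (fun q : TSite d m × ι => q.1)
      (conjHom b (kerOp (blkK L m n) (kQ L m n (fun j => adTransport (𝕜 := ℂ) (UlevOf L m (n + 1) (fun _ : Bond d (towerP L m (n + 1)) => (1 : 𝔸ˣ)) j)))))
      (fun a a'' : TSite d m => if a = a'' then 1 * κ else 0) := by
    rw [kQ_flatLevels_eq]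
    exact hasMajorantHom_kerOp_ind L m n η 0 b hM₂ hrepr 0 True _ zero_le_one fun y x' _ => by
      rw [one_mul]; exact norm_kQ_le L m n _ (fun _ _ v => le_rfl) y x'
  have hs1 : ∀ x', ‖(sQ L m n φ (fun _ : Bond d (towerP L m (n + 1)) => (1 : 𝔸ˣ)) (c₀ := c₀) (c₁ := c₁)) x'‖ ≤ Mφ * Mφ' := fun x' =>
    (norm_sQ_le L m n φ (c₀ := c₀) (c₁ := c₁) (fun _ : Bond d (towerP L m (n + 1)) => (1 : 𝔸ˣ)) hMφ hMφ' hφn hφn' (norm_adTransportW_UlevOf_one_le L m n φ) x').trans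
      (le_of_eq (by rw [hw1, mul_one]))
  have hS1 : HasMajorantHom (g := toB6 (towerGeom L m n η 0) 0 True) (fun q : TSite d m × ι => q.1) (fun p : TSite d (towerP L m (n + 1)) × ι => blkK L m n p.1)
      (conjHom b (liftOp (blkK L m n) (sQ L m n φ (fun _ : Bond d (towerP L m (n + 1)) => (1 : 𝔸ˣ)) (c₀ := c₀) (c₁ := c₁))))
      (fun a a'' : TSite d m => if a = a'' then Mφ * Mφ' * κ else 0) :=
    hasMajorantHom_liftOp_ind L m n η 0 b hM₂ hrepr 0 True _ (mul_nonneg hMφ hMφ') hs1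
  -- (2) the word and its majorant
  have hW := hasMajorant_word5 L m n η 0 0 True (fun p : TSite d (towerP L m (n + 1)) × ι => blkK L m n p.1) (fun q : TSite d m × ι => q.1)
    hBG.le (by positivity) hKc0 (by positivity) hBG.le hδm0 hXF hS1 hc1 hA1 hF
  have hword : conj b (gradLetterF (fun ν => shiftEquiv (Pd := towerP L m (n + 1)) ν) (fun ν y => (fun _ : Bond d (towerP L m (n + 1)) => (1 : 𝔸ˣ)) (y, ν)) ((η : ℂ))⁻¹ μ *
        readA φ (LinearMap.id - RofUk L m n φ η (fun _ : Bond d (towerP L m (n + 1)) => (1 : 𝔸ˣ)) (c₀ := c₀))) =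
      (conj b (gradLetterF (fun ν => shiftEquiv (Pd := towerP L m (n + 1)) ν) (fun ν y => (fun _ : Bond d (towerP L m (n + 1)) => (1 : 𝔸ˣ)) (y, ν)) ((η : ℂ))⁻¹ μ) *
          conj b (readA φ (GpOfUk L m n φ η (fun _ : Bond d (towerP L m (n + 1)) => (1 : 𝔸ˣ)) a' (c₁ := c₁) hpos₁))) ∘ₗ
        (conjHom b (liftOp (blkK L m n) (sQ L m n φ (fun _ : Bond d (towerP L m (n + 1)) => (1 : 𝔸ˣ)) (c₀ := c₀) (c₁ := c₁))) ∘ₗ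
          (conj b (readA φ (greenK _ (QGGQk_pos L m n φ c₀ η (fun _ : Bond d (towerP L m (n + 1)) => (1 : 𝔸ˣ)) c₁ a'
              (adTransportW_adjoint φ τ hτ₂ (star_one_eq_inv_one L m n) hφτ) hpos₁))) ∘ₗ
            (conjHom b (kerOp (blkK L m n) (kQ L m n (fun j => adTransport (𝕜 := ℂ) (UlevOf L m (n + 1) (fun _ : Bond d (towerP L m (n + 1)) => (1 : 𝔸ˣ)) j)))) ∘ₗ
              conj b (readA φ (GpOfUk L m n φ η (fun _ : Bond d (towerP L m (n + 1)) => (1 : 𝔸ˣ)) a' (c₁ := c₁) hpos₁))))) := by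
    rw [B9Eq352DivFormLetters.conj_mul, readA_sub, readA_id, conj_sub, conj_one,
      conj_readA_RofUk_eq L m n φ η (fun _ : Bond d (towerP L m (n + 1)) => (1 : 𝔸ˣ)) a' (adTransportW_adjoint φ τ hτ₂ (star_one_eq_inv_one L m n) hφτ) hpos₁ b,
      sub_sub_cancel, mul_comp_eq]
  rw [← hword] at hW
  -- (3) read back through the seam
  have hoff' : ∀ y, blkK L m n y ≠ v → WL2.equiv ℂ (fun _ : TSite d (towerP L m (n + 1)) => c₀) W h y = 0 := fun y hy =>
    hoff y (by rwa [← blkK_eq_blockCoord_siteCast])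
  have hbd' : ∀ y, blkK L m n y = v → ‖WL2.equiv ℂ (fun _ : TSite d (towerP L m (n + 1)) => c₀) W h y‖ ≤ H := fun y _ => hbd y
  have hrow := gradRowW_of_hasMajorant_conj_gradLetterF_readA φ hMφ hMφ' hφn hφn' b hM₂ hrepr (G := toB6 (towerGeom L m n η 0) 0 True) (blkK L m n)
    _ _ μ _ hW v h H hH hoff' hbd' x
  refine hrow.trans ?_
  have hdist : (toB6 (towerGeom L m n η 0) 0 True).dist (blkK L m n x) v = tdist1 m (blkK L m n x) v := rfl
  have hexp : Real.exp (-((1 - 1 / 2) * δm * (towerGeom L m n η 0).dist (blkK L m n x) v)) ≤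
      Real.exp (-((1 - 1 / 2) * δm * tdist m (blockCoord (L ^ (n + 1)) m (siteCast (towerP_eq_fineP_pow L m (n + 1)) x)) v)) := by
    rw [show (towerGeom L m n η 0).dist (blkK L m n x) v = tdist1 m (blkK L m n x) v from rfl, ← blkK_eq_blockCoord_siteCast]
    exact Real.exp_le_exp.mpr (by nlinarith [tdist_le_tdist1 (blkK L m n x) v, hδm0.le])
  calc Mφ' * ((∑ i, ‖b i‖) * M₂ * (BG * B6.c1 d δm (1 / 2) * (Mφ * Mφ' * κ * (Kc * (1 * κ) * B6.c1 d δm (1 / 2) * BG)) *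
          Real.exp (-((1 - 1 / 2) * δm * (towerGeom L m n η 0).dist (blkK L m n x) v)))) * (Mφ * H)
      ≤ Mφ' * ((∑ i, ‖b i‖) * M₂ * (BG * B6.c1 d δm (1 / 2) * (Mφ * Mφ' * κ * (Kc * (1 * κ) * B6.c1 d δm (1 / 2) * BG)) *
          Real.exp (-((1 - 1 / 2) * δm * tdist m (blockCoord (L ^ (n + 1)) m (siteCast (towerP_eq_fineP_pow L m (n + 1)) x)) v)))) * (Mφ * H) := by
        gcongr
    _ = Mφ' * ((∑ i, ‖b i‖) * M₂ * KW) * Mφ *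
          Real.exp (-((1 - 1 / 2) * δm * tdist m (blockCoord (L ^ (n + 1)) m (siteCast (towerP_eq_fineP_pow L m (n + 1)) x)) v)) * H := by rw [hKW]; ring

end Main

end Literature.MathematicalPhysics.QuantumFieldTheory.Balaban1983to89.B9Eq368TowerProjWordGradientLetters

end
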